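import Summits.RiemannHypothesis.RiemannHypothesis.Theses.WeilComb
import Literature.NumberTheory.LFunctions.WeilExplicit
import Literature.NumberTheory.LFunctions.WeilArchimedeanMoments
import Literature.NumberTheory.LFunctions.WeilMellinBounds
import Literature.NumberTheory.LFunctions.WeilWindowSimpleEven
import Literature.NumberTheory.LFunctions.WeilGroundEnergyProofs

/-!
# Stub `stub_autocorrelation` of line `helson-dirichlet-slack` for crux `WeilComb.CombSubcritical`
(item stmt-RiemannHypothesis-1025, route route-RiemannHypothesis-WeilComb)

Algebraic expansion of the autocorrelation of a log-integer comb. With `φ_ε = ε⁻¹ φ(·/ε)`,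
`ψ_ε = φ_ε ⋆ φ̃_ε` (`φ̃(t) = conj φ(-t)`, `weilReflect`) and the comb
`g(x) = Σ_{m ≤ M} a_m φ_ε(x − log m)`, we prove the identity of functions
`g ⋆ g̃ = Σ_{m, m'} a_m conj(a_{m'}) τ_{log m − log m'} ψ_ε`, where `τ_x h = h(· − x)`
(`weilTranslate`).

Proof. Fix `t`. By `weilConv_apply`, `(g ⋆ g̃)(t) = ∫ g(u) conj(g(u − t)) du`; the integrand is the
finite double sum `Σ_{m,m'} a_m conj(a_{m'}) φ_ε(u − log m) conj(φ_ε(u − t − log m'))`, each term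
being continuous of compact support, hence integrable, so the sums come out of the integral
(`integral_finsetSum`). In each term the substitution `v = u − log m`
(`integral_sub_right_eq_self`) gives `∫ φ_ε(v) conj(φ_ε(v − (t − (log m − log m')))) dv
= ψ_ε(t − (log m − log m'))`, which is the claim. The computation is carried out for an arbitrary
Weil test function `f` in place of `φ_ε` and arbitrary shifts (`weilConv_weilReflect_comb_aux`).
-/

noncomputable section

open scoped BigOperators ComplexConjugate
open Complex MeasureTheory Set

namespace Summit.RiemannHypothesis.RiemannHypothesis.Theorems.WeilCombSubcritical

open Literature.NumberTheory.LFunctions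

/-- `φ_ε = ε⁻¹ φ(·/ε)` is a Weil test function (`ε ≠ 0`). -/
private theorem isWeilTest_dil_autocorr {φ : ℝ → ℂ} {ε : ℝ} (hφ : IsWeilTest φ) (hε : ε ≠ 0) :
    IsWeilTest (fun t : ℝ => (ε : ℂ)⁻¹ * φ (t / ε)) := by
  have h1 : IsWeilTest (fun t : ℝ => φ (t / ε)) := by
    refine ⟨hφ.1.comp (contDiff_id.div_const ε), ?_⟩
    have e : (fun t : ℝ => φ (t / ε)) = φ ∘ (Homeomorph.mulRight₀ ε⁻¹ (inv_ne_zero hε)) := by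
      ext t
      simp [div_eq_mul_inv]
    rw [e]
    exact hφ.2.comp_homeomorph _
  exact h1.const_mul _

/-- Autocorrelation of a finite comb of translates of a single test function `f`:
`(Σ a_m τ_{x_m} f) ⋆ (Σ a_m τ_{x_m} f)~ = Σ_{m,m'} a_m conj(a_{m'}) τ_{x_m − x_{m'}} (f ⋆ f̃)`. -/
private theorem weilConv_weilReflect_comb_aux {f : ℝ → ℂ} (hf : IsWeilTest f)
    (s : Finset ℕ) (a : ℕ → ℂ) (x : ℕ → ℝ) :
    weilConv (fun u : ℝ => ∑ m ∈ s, a m * f (u - x m))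
        (weilReflect (fun u : ℝ => ∑ m ∈ s, a m * f (u - x m))) =
      fun t : ℝ => ∑ m ∈ s, ∑ m' ∈ s,
        a m * conj (a m') * weilTranslate (weilConv f (weilReflect f)) (x m - x m') t := by
  funext t
  have hc : Continuous f := hf.1.continuous
  -- pointwise expansion of the integrand
  have hexp : ∀ u : ℝ,
      (∑ m ∈ s, a m * f (u - x m)) * conj (∑ m ∈ s, a m * f (-(t - u) - x m)) =
        ∑ m ∈ s, ∑ m' ∈ s,
          a m * conj (a m') * (f (u - x m) * conj (f (-(t - (x m - x m') - (u - x m))))) := by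
    intro u
    rw [map_sum, Finset.sum_mul_sum]
    refine Finset.sum_congr rfl fun m _ => Finset.sum_congr rfl fun m' _ => ?_
    rw [map_mul, show -(t - u) - x m' = -(t - (x m - x m') - (u - x m)) by ring]
    ring
  -- integrability of each term
  have hint : ∀ m m' : ℕ, Integrable (fun u : ℝ =>
      a m * conj (a m') * (f (u - x m) * conj (f (-(t - (x m - x m') - (u - x m)))))) := by
    intro m m'
    refine Integrable.const_mul (Continuous.integrable_of_hasCompactSupport ?_ ?_) _
    · exact (hc.comp (continuous_id.sub continuous_const)).mul
        (Complex.continuous_conj.comp (hc.comp (by fun_prop)))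
    · exact HasCompactSupport.mul_right
        (f' := fun u : ℝ => conj (f (-(t - (x m - x m') - (u - x m)))))
        (hf.weilTranslate (x m)).2
  calc weilConv (fun u : ℝ => ∑ m ∈ s, a m * f (u - x m))
        (weilReflect (fun u : ℝ => ∑ m ∈ s, a m * f (u - x m))) t
      = ∫ u, ∑ m ∈ s, ∑ m' ∈ s,
          a m * conj (a m') * (f (u - x m) * conj (f (-(t - (x m - x m') - (u - x m))))) := by
        rw [weilConv_apply]
        congr 1
        funext u
        simp only [weilReflect]
        exact hexp u
    _ = ∑ m ∈ s, ∑ m' ∈ s, ∫ u,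
          a m * conj (a m') * (f (u - x m) * conj (f (-(t - (x m - x m') - (u - x m))))) := by
        rw [integral_finsetSum _ fun m _ => integrable_finsetSum _ fun m' _ => hint m m']
        exact Finset.sum_congr rfl fun m _ => integral_finsetSum _ fun m' _ => hint m m'
    _ = ∑ m ∈ s, ∑ m' ∈ s,
          a m * conj (a m') * weilTranslate (weilConv f (weilReflect f)) (x m - x m') t := by
        refine Finset.sum_congr rfl fun m _ => Finset.sum_congr rfl fun m' _ => ?_
        rw [integral_const_mul]
        congr 1
        simp only [weilTranslate, weilConv_apply, weilReflect]
        exact integral_sub_right_eq_self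
          (fun v : ℝ => f v * conj (f (-(t - (x m - x m') - v)))) (x m)

/-- **Stub 4 — comb autocorrelation.** `g ⋆ g̃ = Σ_{m,m'} a_m conj(a_{m'}) τ_{log m − log m'} ψ_ε`
as functions, `ψ_ε = φ_ε ⋆ φ̃_ε`, `φ_ε = ε⁻¹ φ(·/ε)`, `τ_x h = weilTranslate h x = h(· − x)`. -/
theorem stub_autocorrelation :
    ∀ φ : ℝ → ℂ, IsWeilTest φ → ∀ ε : ℝ, 0 < ε → ∀ (M : ℕ) (a : ℕ → ℂ),
      weilConv (fun x : ℝ => ∑ m ∈ Finset.Icc 1 M, a m * ((ε : ℂ)⁻¹ * φ ((x - Real.log (m : ℝ)) / ε)))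
          (weilReflect (fun x : ℝ => ∑ m ∈ Finset.Icc 1 M,
            a m * ((ε : ℂ)⁻¹ * φ ((x - Real.log (m : ℝ)) / ε)))) =
        fun t : ℝ => ∑ m ∈ Finset.Icc 1 M, ∑ m' ∈ Finset.Icc 1 M,
          a m * conj (a m') *
            weilTranslate (weilConv (fun t : ℝ => (ε : ℂ)⁻¹ * φ (t / ε))
              (weilReflect (fun t : ℝ => (ε : ℂ)⁻¹ * φ (t / ε))))
              (Real.log (m : ℝ) - Real.log (m' : ℝ)) t := by
  intro φ hφ ε hε M a
  exact weilConv_weilReflect_comb_aux (isWeilTest_dil_autocorr hφ hε.ne') (Finset.Icc 1 M) a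
    (fun m : ℕ => Real.log (m : ℝ))

end Summit.RiemannHypothesis.RiemannHypothesis.Theorems.WeilCombSubcritical

end
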